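import Literature.NumberTheory.EllipticCurves.IwasawaAlgebraGenericSpecializationRankProofs
import Literature.NumberTheory.EllipticCurves.IwasawaAlgebraSpecializationTorsionBoundProofs
import Literature.NumberTheory.EllipticCurves.IwasawaAlgebraSpecializationTorsionBoundFamilyProofs
import HarnessLib

/-!
# Route UniversalToricDescent — the `Λ`-RANK is read off at Howard's Eisenstein primes `q_m = T^m + p`:
# `rank_{ℤ_p} X/q_m X = m · rank_Λ X` for all large `m` (any prime `p`; brick E5 — rank half — of the lead's `STUB-BRIEF-K2beta-v7`
# for the port stub K2∣β `stub_residualCorankLeOneMultOfBeta` of line `beta-road` v7 on crux `TwinAlgMuZeroAtThree`, stmt-BirchSwinnertonDyer-24737)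

Width prover `bsd-wall-utd-p1-w2` g11 under lead `bsd-wall-utd-p1` g23 (`--supports stmt-BirchSwinnertonDyer-24737`, helper). THEOREMS ONLY
(no definition, no named fact, no `sorry`); no `Theses` import; pure `Λ = ℤ_p⟦T⟧`-module algebra — nothing arithmetic is asserted and BSD is
not proved by any of this; 24737 stays OPEN.

WHY. The port of K2∣β along the Eisenstein road specialises the `Λ`-adic Kolyvagin system at `q_m = (γ − 1)^m + 3`; Howard's Theorem 1.6.1
over the DVR `S_m = Λ/q_m` returns (i) `H¹_𝓕(K, T_m)` free of rank one and (ii) `H¹_𝓕(K, A_m) ≅ Frac(S_m)/S_m ⊕ M_m ⊕ M_m`, i.e. — after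
control — «`X/q_m X` has `ℤ_p`-rank `m = rank_{ℤ_p} S_m` up to a bounded error». The receptacles E7/E8 (p746766, p747152, p747307) want
`Module.finrank Λ X ≤ 1`. This file is the dictionary between the two: the `q_m`-twin of the tree's LINEAR specialisation theorem
`IwasawaAlgebra.finite_setOf_lambdaInvariant_quotient_X_sub_C_ne_finrank` (`rank_{ℤ_p} M/(T − c)M = rank_Λ M` for almost all `c`).

WHAT (`q_m` spelled `PowerSeries.X ^ m + PowerSeries.C (p : ℤ_[p])`; `ℤ_p`-rank = the tree's `lambdaInvariant p N = dim_{ℚ_p} ℚ_p ⊗_{ℤ_p} N`).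
* §1 `free_finrank_quotient_X_pow_add_C` — `Λ/(q_m)` is `ℤ_p`-free of rank `m` (`m ≥ 1`; Weierstrass division, tree `finrank_quotient_pow`);
  `lambdaInvariant_quotient_X_pow_add_C_eq_of_free` — `rank_{ℤ_p} P/q_m P = rank_Λ P · m` for `P` finitely generated free.
* §2 `finite_torsionBy_and_quotient_X_pow_add_C_of_not_dvd` — for `Q` finitely generated torsion, killed by `f ≠ 0`, and `q_m ∤ f`: `Q[q_m]` and
  `Q/q_m Q` are finite; `finite_setOf_not_finite_torsionBy_and_quotient_X_pow_add_C` — hence finite for all but finitely many `m ≥ 1`.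
* §3 **`exists_forall_lambdaInvariant_quotient_X_pow_add_C_eq`** — for `M` finitely generated: `∃ m₀, ∀ m ≥ m₀, rank_{ℤ_p} M/q_m M = rank_Λ M · m`
  (free `F ≤ M` of full rank with torsion quotient, tree `exists_free_submodule_finrank_eq_isTorsion_quotient`; comparison `F/q_m F → M/q_m M`
  with finite kernel-bound and cokernel, tree `lambdaInvariant_quotient_eq_of_finite`).
* §4 **`finrank_le_of_lambdaInvariant_quotient_X_pow_add_C_le`** — if `rank_{ℤ_p} M/q_m M ≤ r·m + C` for infinitely many `m`, then
  `rank_Λ M ≤ r`; `le_finrank_of_…` — the lower twin; `finrank_le_one_of_…` — the K2∣β shape `r = 1` (the E7/E8 input `finrank Λ X ≤ 1`).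

References: [Howard2004HeegnerKolyvagin] Thm. 1.6.1, proof of Thm. 2.2.10 (arXiv:1202.6340 p. 18); [AgboolaHoward2006] Lemma 1.2.6 (the linear
twin); [Washington1997] §13.2, Prop. 13.8 (`Λ/(f) ≅ ℤ_p^{deg f}`); [GreenbergLNM1716] §4 p. 117.
-/

set_option linter.dupNamespace false
set_option autoImplicit false

noncomputable section

open scoped Classical TensorProduct

namespace Summit.BirchSwinnertonDyer.BirchSwinnertonDyer.Theorems.UniversalToricDescentEisensteinSpecializationRank

open Literature.NumberTheory.EllipticCurves Literature.NumberTheory.EllipticCurves.IwasawaAlgebra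

variable {p : ℕ} [hp : Fact p.Prime]
variable {M : Type*} [AddCommGroup M] [Module (IwasawaAlgebra p) M]

/-! ## §1 `Λ/(q_m)` and free modules -/

/-- `Λ/(q_m)` is a free `ℤ_p`-module of rank `m` for `m ≥ 1` (Weierstrass division by the distinguished polynomial `T^m + p`; Washington
Prop. 13.8). [cite: Washington1997, Prop. 13.8] -/
theorem free_finrank_quotient_X_pow_add_C {m : ℕ} (hm : 1 ≤ m) :
    Module.Free ℤ_[p] (IwasawaAlgebra p ⧸ Ideal.span {(PowerSeries.X ^ m + PowerSeries.C (p : ℤ_[p]) : IwasawaAlgebra p)}) ∧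
    Module.Finite ℤ_[p] (IwasawaAlgebra p ⧸ Ideal.span {(PowerSeries.X ^ m + PowerSeries.C (p : ℤ_[p]) : IwasawaAlgebra p)}) ∧
    Module.finrank ℤ_[p]
      (IwasawaAlgebra p ⧸ Ideal.span {(PowerSeries.X ^ m + PowerSeries.C (p : ℤ_[p]) : IwasawaAlgebra p)}) = m := by
  have hf := isDistinguishedAt_X_pow_add_C p hm
  have he : Ideal.span {((Polynomial.X ^ m + Polynomial.C (p : ℤ_[p]) : Polynomial ℤ_[p]) : IwasawaAlgebra p) ^ 1} =
      Ideal.span {(PowerSeries.X ^ m + PowerSeries.C (p : ℤ_[p]) : IwasawaAlgebra p)} := by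
    rw [pow_one, coe_X_pow_add_C]
  let e := (Ideal.quotientEquivAlgOfEq ℤ_[p] he).toLinearEquiv
  haveI := free_quotient_pow p hf 1
  haveI := finite_quotient_pow p hf 1
  exact ⟨Module.Free.of_equiv e, Module.Finite.equiv e, finrank_quotient_span_X_pow_add_C p hm⟩

/-- **`rank_{ℤ_p} P/q_m P = rank_Λ P · m`** for a finitely generated FREE `Λ`-module `P` and `m ≥ 1`: `P ≅ Λ^r`,
`Λ^r/q_m Λ^r ≅ (Λ/(q_m))^r ≅ ℤ_p^{rm}`. [cite: Washington1997, Prop. 13.8] [cite: AgboolaHoward2006, Lemma 1.2.6 (proof)] -/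
theorem lambdaInvariant_quotient_X_pow_add_C_eq_of_free {P : Type*} [AddCommGroup P]
    [Module (IwasawaAlgebra p) P] [Module.Free (IwasawaAlgebra p) P] [Module.Finite (IwasawaAlgebra p) P]
    {m : ℕ} (hm : 1 ≤ m) :
    lambdaInvariant p (P ⧸ (Ideal.span {(PowerSeries.X ^ m + PowerSeries.C (p : ℤ_[p]) : IwasawaAlgebra p)} •
      (⊤ : Submodule (IwasawaAlgebra p) P))) = Module.finrank (IwasawaAlgebra p) P * m := by
  obtain ⟨hfree, hfin, h1⟩ := free_finrank_quotient_X_pow_add_C (p := p) hm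
  generalize hI : Ideal.span {(PowerSeries.X ^ m + PowerSeries.C (p : ℤ_[p]) : IwasawaAlgebra p)} = I at hfree hfin h1 ⊢
  haveI := hfree
  haveI := hfin
  generalize hr : Module.finrank (IwasawaAlgebra p) P = r
  -- `P ≅ Λ^r`
  let b := Module.Free.chooseBasis (IwasawaAlgebra p) P
  let eP : P ≃ₗ[IwasawaAlgebra p] (Fin r → IwasawaAlgebra p) :=
    (b.reindex (Fintype.equivFinOfCardEq
      ((Module.finrank_eq_card_chooseBasisIndex (R := IwasawaAlgebra p) (M := P)).symm.trans hr))).equivFun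
  -- `P/IP ≅ Λ^r/IΛ^r ≅ (Λ/I•⊤)^r ≅ (Λ/I)^r`
  have hII : (I • (⊤ : Submodule (IwasawaAlgebra p) (IwasawaAlgebra p))) = Submodule.restrictScalars _ I := by
    rw [Ideal.smul_eq_mul, Ideal.mul_top]; rfl
  let e1 : (P ⧸ (I • (⊤ : Submodule (IwasawaAlgebra p) P))) ≃ₗ[IwasawaAlgebra p]
      ((Fin r → IwasawaAlgebra p) ⧸ (I • (⊤ : Submodule (IwasawaAlgebra p) (Fin r → IwasawaAlgebra p)))) :=
    Submodule.Quotient.equiv _ _ eP (by rw [Submodule.map_smul'', Submodule.map_top, LinearEquiv.range])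
  let e2 : ((Fin r → IwasawaAlgebra p) ⧸ (I • (⊤ : Submodule (IwasawaAlgebra p) (Fin r → IwasawaAlgebra p))))
      ≃ₗ[IwasawaAlgebra p] (Fin r → (IwasawaAlgebra p ⧸ I)) :=
    (Submodule.quotEquivOfEq _ _ (Module.smul_top_eq_pi (fun _ : Fin r ↦ IwasawaAlgebra p) I)).trans
      ((Submodule.quotientPi (fun _ : Fin r ↦ (I • (⊤ : Submodule (IwasawaAlgebra p) (IwasawaAlgebra p))))).trans
        (LinearEquiv.piCongrRight fun _ : Fin r ↦
          (Submodule.quotEquivOfEq _ _ hII).trans (Submodule.Quotient.restrictScalarsEquiv (IwasawaAlgebra p) I)))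
  rw [lambdaInvariant_eq_of_linearEquiv (e1.trans e2)]
  -- `rank_{ℤ_p} (Λ/I)^r = r * m`: compare the restricted-scalars structure with the native one
  let N := Fin r → (IwasawaAlgebra p ⧸ I)
  let e3 : RestrictScalars ℤ_[p] (IwasawaAlgebra p) N ≃ₗ[ℤ_[p]] N :=
    { RestrictScalars.addEquiv ℤ_[p] (IwasawaAlgebra p) N with
      map_smul' := fun a x ↦ by
        change (algebraMap ℤ_[p] (IwasawaAlgebra p) a) • (show N from x) = a • (show N from x)
        exact algebraMap_smul (IwasawaAlgebra p) a (show N from x) }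
  unfold lambdaInvariant
  rw [(e3.baseChange ℤ_[p] ℚ_[p] _ _).finrank_eq, Module.finrank_baseChange, Module.finrank_pi_fintype]
  simp [h1]

/-! ## §2 Torsion quotients are `q_m`-generic -/

/-- For `Q` finitely generated, killed by `f`, and `q_m ∤ f` (`m ≥ 1`): `Q[q_m]` and `Q/q_m Q` are FINITE (both are finitely generated
modules over the finite ring `Λ/(f, q_m)`). [cite: Washington1997, §13.2 (Lemma 13.7)] -/
theorem finite_torsionBy_and_quotient_X_pow_add_C_of_not_dvd [Module.Finite (IwasawaAlgebra p) M]
    {f : IwasawaAlgebra p} (hf : ∀ x : M, f • x = 0) {m : ℕ} (hm : 1 ≤ m)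
    (h : ¬ (PowerSeries.X ^ m + PowerSeries.C (p : ℤ_[p]) : IwasawaAlgebra p) ∣ f) :
    Finite (Submodule.torsionBy (IwasawaAlgebra p) M (PowerSeries.X ^ m + PowerSeries.C (p : ℤ_[p]) : IwasawaAlgebra p)) ∧
      Finite (M ⧸ (Ideal.span {(PowerSeries.X ^ m + PowerSeries.C (p : ℤ_[p]) : IwasawaAlgebra p)} •
        (⊤ : Submodule (IwasawaAlgebra p) M))) := by
  haveI : IsNoetherian (IwasawaAlgebra p) M := isNoetherian_of_isNoetherianRing_of_finite _ _
  set θ : IwasawaAlgebra p := PowerSeries.X ^ m + PowerSeries.C (p : ℤ_[p]) with hθ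
  have hprime : Prime θ := prime_X_pow_add_C p hm
  constructor
  · haveI : Module.Finite (IwasawaAlgebra p) (Submodule.torsionBy (IwasawaAlgebra p) M θ) :=
      Module.Finite.iff_fg.mpr (IsNoetherian.noetherian _)
    refine finite_of_smul_eq_zero_of_prime_not_dvd p hprime h (fun x => Subtype.ext ?_) (fun x => Subtype.ext ?_)
    · rw [Submodule.coe_smul, Submodule.coe_zero]; exact hf _
    · rw [Submodule.coe_smul, Submodule.coe_zero]; exact (Submodule.mem_torsionBy_iff θ (x : M)).mp x.2
  · refine finite_of_smul_eq_zero_of_prime_not_dvd p hprime h (fun x => ?_) (fun x => ?_)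
    · induction x using Submodule.Quotient.induction_on with
      | H y => rw [← Submodule.Quotient.mk_smul, hf, Submodule.Quotient.mk_zero]
    · induction x using Submodule.Quotient.induction_on with
      | H y =>
        rw [← Submodule.Quotient.mk_smul, Submodule.Quotient.mk_eq_zero]
        exact Submodule.smul_mem_smul (Ideal.mem_span_singleton_self _) Submodule.mem_top

/-- For a finitely generated TORSION `Λ`-module `Q`, both `Q[q_m]` and `Q/q_m Q` are finite for all but finitely many `m ≥ 1` (the exceptional
`m` are among those with `q_m ∣ f`, `f ≠ 0` an annihilator — finitely many, tree `finite_setOf_X_pow_add_C_dvd`).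
[cite: Washington1997, §13.2] [cite: Howard2004HeegnerKolyvagin, proof of Thm. 2.2.10] -/
theorem finite_setOf_not_finite_torsionBy_and_quotient_X_pow_add_C [Module.Finite (IwasawaAlgebra p) M]
    (hM : Module.IsTorsion (IwasawaAlgebra p) M) :
    {m : ℕ | 1 ≤ m ∧
      ¬ (Finite (Submodule.torsionBy (IwasawaAlgebra p) M (PowerSeries.X ^ m + PowerSeries.C (p : ℤ_[p]) : IwasawaAlgebra p)) ∧
         Finite (M ⧸ (Ideal.span {(PowerSeries.X ^ m + PowerSeries.C (p : ℤ_[p]) : IwasawaAlgebra p)} •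
           (⊤ : Submodule (IwasawaAlgebra p) M))))}.Finite := by
  obtain ⟨f, hfann, hf0⟩ := Submodule.annihilator_top_inter_nonZeroDivisors hM
  have hf0' : (f : IwasawaAlgebra p) ≠ 0 := nonZeroDivisors.ne_zero hf0
  have hf : ∀ x : M, f • x = 0 := fun x => Submodule.mem_annihilator.mp hfann x Submodule.mem_top
  refine (finite_setOf_X_pow_add_C_dvd p hf0').subset ?_
  rintro m ⟨hm, hnot⟩
  refine ⟨hm, ?_⟩
  by_contra hndvd
  exact hnot (finite_torsionBy_and_quotient_X_pow_add_C_of_not_dvd hf hm hndvd)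

/-! ## §3 The main theorem: `rank_{ℤ_p} M/q_m M = rank_Λ M · m` for all large `m` -/

/-- **Eisenstein specialisations read off the `Λ`-rank.** For a finitely generated `Λ`-module `M` there is `m₀` such that
`rank_{ℤ_p} M/q_m M = rank_Λ M · m` for every `m ≥ m₀` (`q_m = T^m + p`): with `F ≤ M` free of full rank and `Q = M/F` finitely generated
torsion, for all large `m` both `Q[q_m]` and `Q/q_m Q` are finite (§2), so `rank_{ℤ_p} F/q_m F = rank_{ℤ_p} M/q_m M`
(tree `lambdaInvariant_quotient_eq_of_finite`), and `rank_{ℤ_p} F/q_m F = rank_Λ F · m` (§1).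
[cite: AgboolaHoward2006, Lemma 1.2.6] [cite: Howard2004HeegnerKolyvagin, proof of Thm. 2.2.10] [cite: Washington1997, §13.2] -/
theorem exists_forall_lambdaInvariant_quotient_X_pow_add_C_eq [Module.Finite (IwasawaAlgebra p) M] :
    ∃ m₀ : ℕ, ∀ m : ℕ, m₀ ≤ m →
      lambdaInvariant p (M ⧸ (Ideal.span {(PowerSeries.X ^ m + PowerSeries.C (p : ℤ_[p]) : IwasawaAlgebra p)} •
        (⊤ : Submodule (IwasawaAlgebra p) M))) = Module.finrank (IwasawaAlgebra p) M * m := by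
  obtain ⟨F, hFfree, hFfin, hFrank, hQ⟩ := exists_free_submodule_finrank_eq_isTorsion_quotient p (M := M)
  haveI := hFfree
  haveI := hFfin
  have hbad := finite_setOf_not_finite_torsionBy_and_quotient_X_pow_add_C (p := p) (M := M ⧸ F) hQ
  obtain ⟨N, hN⟩ := hbad.bddAbove
  refine ⟨N + 1, fun m hm => ?_⟩
  have hm1 : 1 ≤ m := le_trans (Nat.le_add_left 1 N) hm
  have hgood : Finite (Submodule.torsionBy (IwasawaAlgebra p) (M ⧸ F)
        (PowerSeries.X ^ m + PowerSeries.C (p : ℤ_[p]) : IwasawaAlgebra p)) ∧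
      Finite ((M ⧸ F) ⧸ (Ideal.span {(PowerSeries.X ^ m + PowerSeries.C (p : ℤ_[p]) : IwasawaAlgebra p)} •
        (⊤ : Submodule (IwasawaAlgebra p) (M ⧸ F)))) := by
    by_contra hnot
    have hmem : m ∈ {m : ℕ | 1 ≤ m ∧
        ¬ (Finite (Submodule.torsionBy (IwasawaAlgebra p) (M ⧸ F)
              (PowerSeries.X ^ m + PowerSeries.C (p : ℤ_[p]) : IwasawaAlgebra p)) ∧
           Finite ((M ⧸ F) ⧸ (Ideal.span {(PowerSeries.X ^ m + PowerSeries.C (p : ℤ_[p]) : IwasawaAlgebra p)} •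
             (⊤ : Submodule (IwasawaAlgebra p) (M ⧸ F)))))} := ⟨hm1, hnot⟩
    have := hN hmem
    omega
  rw [← lambdaInvariant_quotient_eq_of_finite p F _ hgood.1 hgood.2,
    lambdaInvariant_quotient_X_pow_add_C_eq_of_free (p := p) hm1, hFrank]

/-! ## §4 Reading the `Λ`-rank off `ℤ_p`-rank bounds at infinitely many `q_m` -/

/-- **Upper bound.** If `rank_{ℤ_p} M/q_m M ≤ r·m + C` for infinitely many `m`, then `rank_Λ M ≤ r`.
[cite: Howard2004HeegnerKolyvagin, proof of Thm. 2.2.10] [cite: AgboolaHoward2006, Lemma 1.2.6] -/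
theorem finrank_le_of_lambdaInvariant_quotient_X_pow_add_C_le [Module.Finite (IwasawaAlgebra p) M] (r C : ℕ)
    (h : ∀ m₀ : ℕ, ∃ m : ℕ, m₀ ≤ m ∧
      lambdaInvariant p (M ⧸ (Ideal.span {(PowerSeries.X ^ m + PowerSeries.C (p : ℤ_[p]) : IwasawaAlgebra p)} •
        (⊤ : Submodule (IwasawaAlgebra p) M))) ≤ r * m + C) :
    Module.finrank (IwasawaAlgebra p) M ≤ r := by
  obtain ⟨m₀, hm₀⟩ := exists_forall_lambdaInvariant_quotient_X_pow_add_C_eq (p := p) (M := M)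
  obtain ⟨m, hm, hle⟩ := h (max m₀ (C + 1))
  have hm0 : m₀ ≤ m := le_trans (le_max_left _ _) hm
  have hmC : C + 1 ≤ m := le_trans (le_max_right _ _) hm
  rw [hm₀ m hm0] at hle
  -- `rank · m ≤ r · m + C < (r + 1) · m`
  by_contra hlt
  rw [not_le] at hlt
  have h1 : (r + 1) * m ≤ Module.finrank (IwasawaAlgebra p) M * m := Nat.mul_le_mul_right m hlt
  have h2 : (r + 1) * m ≤ r * m + C := h1.trans hle
  rw [Nat.add_mul, one_mul] at h2
  omega

/-- **Lower bound.** If `r·m ≤ rank_{ℤ_p} M/q_m M + C` for infinitely many `m`, then `r ≤ rank_Λ M`.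
[cite: Howard2004HeegnerKolyvagin, proof of Thm. 2.2.10] [cite: AgboolaHoward2006, Lemma 1.2.6] -/
theorem le_finrank_of_le_lambdaInvariant_quotient_X_pow_add_C [Module.Finite (IwasawaAlgebra p) M] (r C : ℕ)
    (h : ∀ m₀ : ℕ, ∃ m : ℕ, m₀ ≤ m ∧
      r * m ≤ lambdaInvariant p (M ⧸ (Ideal.span {(PowerSeries.X ^ m + PowerSeries.C (p : ℤ_[p]) : IwasawaAlgebra p)} •
        (⊤ : Submodule (IwasawaAlgebra p) M))) + C) :
    r ≤ Module.finrank (IwasawaAlgebra p) M := by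
  obtain ⟨m₀, hm₀⟩ := exists_forall_lambdaInvariant_quotient_X_pow_add_C_eq (p := p) (M := M)
  obtain ⟨m, hm, hle⟩ := h (max m₀ (C + 1))
  have hm0 : m₀ ≤ m := le_trans (le_max_left _ _) hm
  have hmC : C + 1 ≤ m := le_trans (le_max_right _ _) hm
  rw [hm₀ m hm0] at hle
  by_contra hlt
  rw [not_le] at hlt
  have h1 : (Module.finrank (IwasawaAlgebra p) M + 1) * m ≤ r * m := Nat.mul_le_mul_right m hlt
  rw [Nat.add_mul, one_mul] at h1
  omega

/-- **The K2∣β shape (`r = 1`)**: if `rank_{ℤ_p} X/q_m X ≤ m + C` for infinitely many `m` — what Howard's Thm. 1.6.1 over `S_m = Λ/q_m`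
(`H¹_𝓕(K, A_m) ≅ Frac(S_m)/S_m ⊕ M_m ⊕ M_m`, `rank_{ℤ_p} S_m = m`) delivers after control — then `Module.finrank Λ X ≤ 1`, the rank input of
the receptacles `…ResidualRankLeOneGrowth` / `…ResidualGrowthSelmerSide` (p747152/p747307). [cite: Howard2004HeegnerKolyvagin, Thm. 1.6.1, Thm. B] -/
theorem finrank_le_one_of_lambdaInvariant_quotient_X_pow_add_C_le [Module.Finite (IwasawaAlgebra p) M] (C : ℕ)
    (h : ∀ m₀ : ℕ, ∃ m : ℕ, m₀ ≤ m ∧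
      lambdaInvariant p (M ⧸ (Ideal.span {(PowerSeries.X ^ m + PowerSeries.C (p : ℤ_[p]) : IwasawaAlgebra p)} •
        (⊤ : Submodule (IwasawaAlgebra p) M))) ≤ m + C) :
    Module.finrank (IwasawaAlgebra p) M ≤ 1 :=
  finrank_le_of_lambdaInvariant_quotient_X_pow_add_C_le (p := p) 1 C (by simpa only [one_mul] using h)

/-- **Exact form**: if `rank_{ℤ_p} M/q_m M = r·m` for infinitely many `m`, then `rank_Λ M = r`. [cite: AgboolaHoward2006, Lemma 1.2.6] -/
theorem finrank_eq_of_lambdaInvariant_quotient_X_pow_add_C_eq [Module.Finite (IwasawaAlgebra p) M] (r : ℕ)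
    (h : ∀ m₀ : ℕ, ∃ m : ℕ, m₀ ≤ m ∧
      lambdaInvariant p (M ⧸ (Ideal.span {(PowerSeries.X ^ m + PowerSeries.C (p : ℤ_[p]) : IwasawaAlgebra p)} •
        (⊤ : Submodule (IwasawaAlgebra p) M))) = r * m) :
    Module.finrank (IwasawaAlgebra p) M = r := by
  refine le_antisymm (finrank_le_of_lambdaInvariant_quotient_X_pow_add_C_le (p := p) r 0 fun m₀ => ?_)
    (le_finrank_of_le_lambdaInvariant_quotient_X_pow_add_C (p := p) r 0 fun m₀ => ?_)
  · obtain ⟨m, hm, he⟩ := h m₀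
    exact ⟨m, hm, by rw [he, add_zero]⟩
  · obtain ⟨m, hm, he⟩ := h m₀
    exact ⟨m, hm, by rw [he, add_zero]⟩

end Summit.BirchSwinnertonDyer.BirchSwinnertonDyer.Theorems.UniversalToricDescentEisensteinSpecializationRank

end
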